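import Mathlib
import Literature.AlgebraicGeometry.HodgeTheory.GysinFormalismCorrespondences
import Literature.AlgebraicGeometry.HodgeTheory.ZariskiClosedNowhereDense
import Literature.AlgebraicGeometry.HodgeTheory.HypersurfaceLefschetzIntegral
import Literature.AlgebraicGeometry.HodgeTheory.HolomorphicBundleChernCharacterProjectiveSpace
import Literature.AlgebraicGeometry.Motives.AbelianVarietyComplexPoints
import Literature.AlgebraicGeometry.Motives.Sweep1
import Literature.AlgebraicTopology.SingularHomology.CohomologyOfPoint
import Literature.NumberTheory.Transcendental.AnalytificationProjProofs
import HarnessLib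

/-!
# AbelianVarietyRationalCurves

Topic `Literature/AlgebraicGeometry/Motives`. Named literature fact(s) relocated by the gate from `Summits/HodgeConjecture/HodgeConjecture/Theorems/PadicSemiregularLiftHodgeBeyondAnchorsProductsNotAnchors.lean`
(accept-time relocation of `[cite]`d propositions written inline in a Summits proposal; human ruling 2026-08-15).
Sources: Milne1986AbelianVarieties.

* `Literature.AlgebraicGeometry.Motives.Milne1986_projectiveLine_to_abelianVariety_const`
-/

namespace Literature.AlgebraicGeometry.Motives

open CategoryTheory AlgebraicGeometry MonoidalCategory CartesianMonoidalCategory Topology Limits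
open Literature.AlgebraicTopology.SingularHomology
open Literature.AlgebraicGeometry Literature.AlgebraicGeometry.HodgeTheory

/-- **Abelian varieties contain no rational curves** (Milne, *Abelian Varieties*, §3 Cor. 3.8:
"Every rational map `f : ℙ¹ → A` is constant"). Stated for morphisms: for an abelian variety `A`
over a field `k`, every `k`-morphism `ℙ¹_k → A` is constant on the underlying topological spaces.
-- TODO(general form): Milne's statement is for rational maps `ℙ¹ ⇢ A` (which extend to morphisms
-- by his Thm. 3.1, the tree's `AbelianVariety.existsUnique_extension`).
[cite: Milne1986AbelianVarieties, §3 Cor. 3.8 (p. 107)]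
[file AlgebraicGeometry/Motives/AbelianVarietyRationalCurves] -/
def Milne1986_projectiveLine_to_abelianVariety_const : Prop :=
  ∀ (k : Type*) [Field k] (A : Literature.AlgebraicGeometry.Motives.AbelianVariety k)
    (f : Literature.AlgebraicGeometry.Motives.projectiveSpace 1 k ⟶ A.X)
    (a b : ↥(Literature.AlgebraicGeometry.Motives.projectiveSpace 1 k).left),
    f.left.base a = f.left.base b

end Literature.AlgebraicGeometry.Motives
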